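import Summits.QuantumFields.YangMills.Theorems.LangevinControlUVOSLegsFromFemtoAndGapDefsR3
import Summits.QuantumFields.YangMills.Theorems.LangevinControlUVOSLegsFromFemtoAndGapStubHypercubicTimeReflection
import Summits.QuantumFields.YangMills.Theorems.LangevinControlUVOSLegsFromFemtoAndGapStubHypercubicSignedPerm

/-!
# Stub `stub_hypercubic` of line `dlr-collar-transfer` (crux `OSLegsFromFemtoAndGap`, stmt-QuantumFields-9367)

`theorem stub_hypercubic : Statement.stub_hypercubic` — the registered stub of reshape r3 of the skeleton
`Cruxes/OSLegsFromFemtoAndGap/Lines/dlr_collar_transfer.lean` (§4.2 of `…DefsR3.lean`): along any soft bundle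
`(sch, S₁, Tq, K, b₀, g)` the limit family `S₁` is invariant on `⁰𝒮` under every linear isometry of `ℝ⁴`
permuting the coordinate axes up to signs.

* Coordinate permutations are exact lattice symmetries (toolkit XXIII, `softLimit_linActMulti_coordPerm`).
* Time reflection `Θ = thetaMulti 4`: by toolkit XXIV-a (`norm_latticeDist_dens_thetaMulti_sub_le`, fed with the
  bundle's shift-defect clause, its ranges clause `a_k ≤ 1/24`, `14 ≤ L_k`, `a_k⁻² ≤ L_k`, and the sup bound of the
  plane fields) the centred density distributions of `ΘF` and `F` differ by `O(a_k) → 0`, so both converge to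
  `S₁ n F`; but those of `ΘF ∈ ⁰𝒮` converge to `S₁ n (ΘF)` (bundle convergence clause), whence `S₁ n (ΘF) = S₁ n F`
  for `n ≥ 2` (and trivially for `n ≤ 1` from `S₁ 0 = ev`, `S₁ 1 = 0`).
* Signed permutations = permutations ∘ axis reflections (toolkit XXIV-b, `invariant_linActMulti_of_signedPerm`).
-/

set_option autoImplicit false

noncomputable section

open scoped SchwartzMap
open MeasureTheory Filter Topology
open Literature.MathematicalPhysics.QuantumFieldTheory Literature.MathematicalPhysics.QuantumLattice
open Literature.MathematicalPhysics.AQFT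
open Summit.QuantumFields.YangMills.Theorems.OSLegsFromFemtoAndGap

namespace Summit.QuantumFields.YangMills.Cruxes.OSLegsFromFemtoAndGap.DlrCollarTransfer

/-- Registered stub `stub_hypercubic` (**signed permutations of the axes**): along any soft bundle the limit
family is invariant on `⁰𝒮` under every linear isometry `R` of `ℝ⁴` with `R eᵢ = ±e_{σ i}` — coordinate
permutations are exact on the lattice, the time reflection costs `O(a_k)` (one-step shifts of the reflected
plaquette corners, absorbed by the shift-defect clause, plus the wrap-around), and a signed permutation is a
permutation composed with axis reflections `P_{(0 i)} Θ P_{(0 i)}`. -/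
theorem stub_hypercubic : Statement.stub_hypercubic := by
  intro G _ _ _ _ _ _ r a sch S₁ Tq K b₀ g hB n R hR F hF
  obtain ⟨⟨-, -, -, -, -, -, -, -, hS₁0, hS₁1, hconv, hbd, -, -, -, -, hranges, -, Hdef, -, -⟩, -⟩ := hB
  -- coordinate permutations (toolkit XXIII)
  have hperm : ∀ (π : Equiv.Perm (Fin 4)) (n : ℕ) (F : 𝓢((Fin n → EuclideanSpace ℝ (Fin 4)), ℂ)),
      IsOffDiagonal F → S₁ n (linActMulti (coordPerm π) F) = S₁ n F := fun π n F hF =>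
    softLimit_linActMulti_coordPerm r S₁ hS₁0 hS₁1 hconv π n F hF
  -- the time reflection (toolkit XXIV-a + uniqueness of limits)
  have hθ : ∀ (n : ℕ) (F : 𝓢((Fin n → EuclideanSpace ℝ (Fin 4)), ℂ)), IsOffDiagonal F →
      S₁ n (thetaMulti 4 F) = S₁ n F := by
    intro n F hF
    rcases Nat.lt_or_ge n 2 with hn | hn
    · interval_cases n
      · rw [hS₁0, hS₁0, thetaMulti_apply]
        congr 1
        exact Subsingleton.elim _ _
      · rw [hS₁1, hS₁1]
    · obtain ⟨Cp, hCp⟩ := exists_abs_plane_le (G := G) r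
      -- the constant of the `O(a)` bound
      set B : ℝ := 6 ^ n * (2 * 3 ^ (4 * n) * 2 ^ (8 * n + 1) * (Cp + Cp) ^ n *
          SchwartzMap.seminorm ℂ (8 * n + 1) 0 F +
        2 * K ^ n * (SchwartzMap.seminorm ℂ 0 (4 * n + 1) F + SchwartzMap.seminorm ℂ (6 * n) (4 * n + 1) F +
          SchwartzMap.seminorm ℂ 0 1 F + SchwartzMap.seminorm ℂ (6 * n) 1 F +
          SchwartzMap.seminorm ℂ (10 * n) 1 F)) with hBdef
      have hbound : ∀ k, ‖latticeDist r.ρ (sch.β k) (sch.L k) (sch.a k) r.curvature.F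
          (wilsonTorusMean r.ρ (sch.β k) (sch.L k) r.curvature.F) n (thetaMulti 4 F) -
          latticeDist r.ρ (sch.β k) (sch.L k) (sch.a k) r.curvature.F
            (wilsonTorusMean r.ρ (sch.β k) (sch.L k) r.curvature.F) n F‖ ≤ B * sch.a k := by
        intro k
        obtain ⟨-, -, hL14, hLa⟩ := hranges k
        have h := norm_latticeDist_dens_thetaMulti_sub_le r (sch.β k) (sch.L k) (sch.a_pos k) (by omega) hLa hbd.1
          hCp (fun q hq F hF c hc => Hdef k n hn q hq F hF c hc) F hF
        rw [hBdef, mul_assoc]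
        exact h
      have hdiff : Tendsto (fun k => latticeDist r.ρ (sch.β k) (sch.L k) (sch.a k) r.curvature.F
          (wilsonTorusMean r.ρ (sch.β k) (sch.L k) r.curvature.F) n (thetaMulti 4 F) -
          latticeDist r.ρ (sch.β k) (sch.L k) (sch.a k) r.curvature.F
            (wilsonTorusMean r.ρ (sch.β k) (sch.L k) r.curvature.F) n F) atTop (𝓝 0) := by
        refine squeeze_zero_norm hbound ?_
        simpa using sch.tendsto_a.const_mul B
      have hlimΘ : Tendsto (fun k => latticeDist r.ρ (sch.β k) (sch.L k) (sch.a k) r.curvature.F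
          (wilsonTorusMean r.ρ (sch.β k) (sch.L k) r.curvature.F) n (thetaMulti 4 F)) atTop (𝓝 (S₁ n F)) := by
        have h := (hconv n hn F hF).add hdiff
        simp only [add_zero, add_sub_cancel] at h
        exact h
      exact tendsto_nhds_unique (hconv n hn (thetaMulti 4 F) (hF.linActMulti (timeReflection 4))) hlimΘ
  exact invariant_linActMulti_of_signedPerm hperm hθ R hR n F hF

end Summit.QuantumFields.YangMills.Cruxes.OSLegsFromFemtoAndGap.DlrCollarTransfer

end
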